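import Literature.NumberTheory.Kottwitz1992.Involutions
import Mathlib.LinearAlgebra.BilinearForm.Orthogonal
import Mathlib.Algebra.DirectSum.Module
import HarnessLib

/-!
# [Kottwitz1992, Lemma 2.1 p. 379] Positive definite Hermitian `B`-modules are orthogonal sums of irreducibles — DISCHARGED:
# `Kottwitz1992_2_1_posDef_directSum_irreducible_holds`

Kernel-lane companion of the statement carpet ★ `Literature/NumberTheory/Kottwitz1992/Involutions.lean` (squad TK; ★ `InvolutionsHolds`
pays Lemma 2.3 (1)): the named fact ★ `Involutions.Kottwitz1992_2_1_posDef_directSum_irreducible` — «Any positive definite Hermitian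
`B`-module `V` can be written as a direct sum of positive definite Hermitian `B`-modules that are irreducible as `B`-modules» — is PROVED
here.  THEOREMS ONLY (no definition, no named fact, no `sorry`, no instance, no notation); cell hodgecm-mathlib, seat B-typ02 (g31); net
debt −1.

R. E. Kottwitz, *Points on some Shimura varieties over finite fields*, J. Amer. Math. Soc. 5 (1992), Lemma 2.1 p. 379 (held
`paper:doi-10-2307-2152772`, p0007 L24–L31).  THE PRINTED PROOF: «Use induction on the length of `V`.  If the length is `0`, there is
nothing to do.  Otherwise choose an irreducible submodule `W` of `V`.  Then a Hermitian `B`-module `V` is the direct sum of `W` and its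
orthogonal complement.  Now apply the induction hypothesis to this orthogonal complement.»  Formalised verbatim, inside the lattice of
`B`-submodules of `V` (§2, strong induction on `dim_ℝ N` for `N ≤ V`, which bounds the length): an irreducible `W ≤ N` exists because `B` is a
semisimple ring (Mathlib: the lattice of submodules is atomic); the orthogonal complement `W^⊥` is a `B`-submodule because the form is
Hermitian (§1); `N = W ⊕ (N ∩ W^⊥)` because the form is positive definite on `W` (Mathlib
`LinearMap.BilinForm.isCompl_orthogonal_of_restrict_nondegenerate`); the summands are collected with `Matrix.vecCons`, and the independence of the
pairwise orthogonal family — hence the internal direct sum — follows from positivity (§3).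
HONEST LABEL: HC_CM is proved only modulo the 7 printed citations (2 remaining: hLiu418, h413) until rung 0 closes; this file adds no citation
debt (0 facts, 0 sorry) and discharges 1 named fact of ★ `Involutions`.

## References
* [Kottwitz1992] R. E. Kottwitz, Points on some Shimura varieties over finite fields, J. Amer. Math. Soc. 5 (1992) 373–444, Lemma 2.1 p. 379.
-/

namespace Literature.NumberTheory.Kottwitz1992.Involutions

universe u

variable {B : Type u} [Ring B] [Algebra ℝ B] (ι : B →ₗ[ℝ] B)
variable {V : Type u} [AddCommGroup V] [Module ℝ V] [Module B V] [IsScalarTower ℝ B V]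

/-! ## §1 The orthogonal complement of a `B`-submodule is a `B`-submodule -/

omit [IsScalarTower ℝ B V] in
/-- For a Hermitian form `φ` («`(bv, w) = (v, b*w)`», symmetric) the orthogonal complement `S^⊥ = {v | (s, v) = 0 ∀ s ∈ S}` of a
`B`-submodule `S` is again a `B`-submodule: `(s, bv) = (b* s, v) = 0` (p. 379 L29–L30: «its orthogonal complement»).
[cite: Kottwitz1992, Lemma 2.1 (p. 379)] -/
private theorem exists_orthogonal_submodule {φ : LinearMap.BilinForm ℝ V} (hφ : IsHermitianForm B V ι φ)
    (S : Submodule B V) : ∃ T : Submodule B V, ∀ v : V, v ∈ T ↔ ∀ s ∈ S, φ s v = 0 :=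
  ⟨{ carrier := {v | ∀ s ∈ S, φ s v = 0}
     add_mem' := fun {v w} hv hw s hs => by rw [map_add, hv s hs, hw s hs, add_zero]
     zero_mem' := fun s _ => by rw [map_zero]
     smul_mem' := fun b v hv s hs => by
       show φ s (b • v) = 0
       rw [hφ.symm, hφ.smul_left, hφ.symm]
       exact hv _ (S.smul_mem (ι b) hs) }, fun _ => Iff.rfl⟩

/-! ## §2 The induction on the length (p. 379 L28–L31), inside the lattice of `B`-submodules of `V` -/

/-- **The printed induction**: every `B`-submodule `N` of a positive definite Hermitian `B`-module `V` (`B` finite-dimensional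
semisimple over `ℝ`, `V` finitely generated) is the supremum of finitely many pairwise `φ`-orthogonal irreducible `B`-submodules —
«choose an irreducible submodule `W` […] `V` is the direct sum of `W` and its orthogonal complement […] apply the induction hypothesis to
this orthogonal complement». [cite: Kottwitz1992, Lemma 2.1 (p. 379)] -/
private theorem exists_orthogonal_simple_family (hA : IsAlgebraWithInvolution B ι) [Module.Finite B V]
    {φ : LinearMap.BilinForm ℝ V} (hφ : IsPosDefHermitianForm B V ι φ) (N : Submodule B V) :
    ∃ (n : ℕ) (W : Fin n → Submodule B V), (∀ i, W i ≤ N) ∧ (⨆ i, W i) = N ∧ (∀ i, IsSimpleModule B (W i)) ∧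
      ∀ i j, i ≠ j → ∀ v ∈ W i, ∀ w ∈ W j, φ v w = 0 := by
  haveI := hA.finiteDimensional
  haveI := hA.isSemisimpleRing
  haveI : Module.Finite ℝ V := Module.Finite.trans B V
  have hrefl : φ.IsRefl := fun x y h => by rw [hφ.1.symm]; exact h
  suffices h : ∀ (d : ℕ) (N : Submodule B V), Module.finrank ℝ (N.restrictScalars ℝ) = d →
      ∃ (n : ℕ) (W : Fin n → Submodule B V), (∀ i, W i ≤ N) ∧ (⨆ i, W i) = N ∧ (∀ i, IsSimpleModule B (W i)) ∧
        ∀ i j, i ≠ j → ∀ v ∈ W i, ∀ w ∈ W j, φ v w = 0 from h _ N rfl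
  intro d
  induction d using Nat.strong_induction_on with
  | _ d ih => ?_
  intro N hd
  rcases IsAtomic.eq_bot_or_exists_atom_le N with hN | ⟨S, hS, hSN⟩
  · -- length `0`: «there is nothing to do»
    refine ⟨0, Fin.elim0, fun i => i.elim0, ?_, fun i => i.elim0, fun i => i.elim0⟩
    rw [hN, iSup_of_empty]
  · -- an irreducible submodule `S ≤ N` and its orthogonal complement `T = S^⊥`
    obtain ⟨T, hT⟩ := exists_orthogonal_submodule ι hφ.1 S
    -- `φ` is nondegenerate on `S` (positive definite), so `V = S ⊕ S^⊥` over `ℝ`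
    have hnd : (φ.restrict (S.restrictScalars ℝ)).Nondegenerate := by
      refine ⟨fun x hx => ?_, fun y hy => ?_⟩
      · by_contra hx0
        have hx' : (x : V) ≠ 0 := fun h0 => hx0 (Subtype.ext h0)
        exact (hφ.2 _ hx').ne' (by simpa using hx x)
      · by_contra hy0
        have hy' : (y : V) ≠ 0 := fun h0 => hy0 (Subtype.ext h0)
        exact (hφ.2 _ hy').ne' (by simpa using hy y)
    have hc := LinearMap.BilinForm.isCompl_orthogonal_of_restrict_nondegenerate hrefl hnd
    -- `N = S ⊔ (N ⊓ S^⊥)`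
    have hsup : S ⊔ N ⊓ T = N := by
      refine le_antisymm (sup_le hSN inf_le_left) fun v hv => ?_
      have hv' : v ∈ S.restrictScalars ℝ ⊔ φ.orthogonal (S.restrictScalars ℝ) := by
        rw [hc.sup_eq_top]; exact Submodule.mem_top
      obtain ⟨y, hy, z, hz, rfl⟩ := Submodule.mem_sup.1 hv'
      rw [Submodule.restrictScalars_mem] at hy
      refine Submodule.mem_sup.2 ⟨y, hy, z, Submodule.mem_inf.2 ⟨?_, (hT z).2 fun s hs => ?_⟩, rfl⟩
      · simpa using N.sub_mem hv (hSN hy)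
      · exact LinearMap.BilinForm.mem_orthogonal_iff.1 hz s hs
    -- `S ∩ S^⊥ = 0`, so the complement is a proper submodule of `N`: the length drops
    have hlt : Module.finrank ℝ ((N ⊓ T).restrictScalars ℝ) < d := by
      rw [← hd]
      refine Submodule.finrank_lt_finrank_of_lt (lt_of_le_of_ne (fun v hv => ?_) fun heq => hS.1 ?_)
      · exact (Submodule.mem_inf.1 (show v ∈ N ⊓ T from hv)).1
      · rw [eq_bot_iff]
        intro v hvS
        have hvN : v ∈ (N ⊓ T).restrictScalars ℝ := by rw [heq]; exact hSN hvS
        have hvT : v ∈ T := (Submodule.mem_inf.1 (show v ∈ N ⊓ T from hvN)).2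
        by_contra hv0
        exact (hφ.2 v hv0).ne' ((hT v).1 hvT v hvS)
    -- the induction hypothesis for the orthogonal complement, and `Fin.cons`
    obtain ⟨n', W', hle', hsup', hsimple', horth'⟩ := ih _ hlt (N ⊓ T) rfl
    have hleN : ∀ i, Matrix.vecCons S W' i ≤ N := fun i => by
      refine Fin.cases ?_ (fun j => ?_) i
      · rw [Matrix.cons_val_zero]; exact hSN
      · rw [Matrix.cons_val_succ]; exact (hle' j).trans inf_le_left
    refine ⟨n' + 1, Matrix.vecCons S W', hleN, ?_, fun i => ?_, fun i j hij v hv w hw => ?_⟩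
    · refine le_antisymm (iSup_le hleN) ?_
      rw [← hsup, ← hsup']
      refine sup_le ?_ (iSup_le fun j => ?_)
      · have h0 := le_iSup (Matrix.vecCons S W') 0
        rwa [Matrix.cons_val_zero] at h0
      · have hj := le_iSup (Matrix.vecCons S W') j.succ
        rwa [Matrix.cons_val_succ] at hj
    · refine Fin.cases ?_ (fun j => ?_) i
      · rw [Matrix.cons_val_zero]; exact isSimpleModule_iff_isAtom.2 hS
      · rw [Matrix.cons_val_succ]; exact hsimple' j
    · rcases i.eq_zero_or_eq_succ with rfl | ⟨k, rfl⟩ <;> rcases j.eq_zero_or_eq_succ with rfl | ⟨l, rfl⟩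
      · exact absurd rfl hij
      · rw [Matrix.cons_val_zero] at hv
        rw [Matrix.cons_val_succ] at hw
        exact (hT w).1 (Submodule.mem_inf.1 (hle' l hw)).2 v hv
      · rw [Matrix.cons_val_succ] at hv
        rw [Matrix.cons_val_zero] at hw
        rw [hφ.1.symm]
        exact (hT v).1 (Submodule.mem_inf.1 (hle' k hv)).2 w hw
      · rw [Matrix.cons_val_succ] at hv hw
        exact horth' k l (fun h => hij (by rw [h])) v hv w hw

/-! ## §3 Independence of an orthogonal family, and the discharge -/

/-- **LEMMA 2.1, PROVED**: ★ `Kottwitz1992_2_1_posDef_directSum_irreducible` holds — a positive definite Hermitian `B`-module (`B` a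
finite-dimensional semisimple `ℝ`-algebra with involution) is the internal direct sum of finitely many pairwise orthogonal irreducible
`B`-submodules: §2 at `N = V`, the family being independent because a vector of `W_i` lying in `⨆_{j ≠ i} W_j ⊆ W_i^⊥` is isotropic,
hence `0` by positivity. [cite: Kottwitz1992, Lemma 2.1 (p. 379)] -/
theorem Kottwitz1992_2_1_posDef_directSum_irreducible_holds : Kottwitz1992_2_1_posDef_directSum_irreducible B ι := by
  intro hA V _ _ _ _ _ φ hφ
  obtain ⟨n, W, -, hsup, hsimple, horth⟩ := exists_orthogonal_simple_family ι hA hφ ⊤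
  refine ⟨n, W, DirectSum.isInternal_submodule_of_iSupIndep_of_iSup_eq_top ?_ hsup, hsimple, horth⟩
  refine iSupIndep_def.2 fun i => ?_
  obtain ⟨T, hT⟩ := exists_orthogonal_submodule ι hφ.1 (W i)
  have hle : (⨆ (j) (_ : j ≠ i), W j) ≤ T :=
    iSup₂_le fun j hj w hw => (hT w).2 fun v hv => horth i j (Ne.symm hj) v hv w hw
  rw [Submodule.disjoint_def]
  intro v hv hv'
  by_contra hv0
  exact (hφ.2 v hv0).ne' ((hT v).1 (hle hv') v hv)

end Literature.NumberTheory.Kottwitz1992.Involutions
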